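import Mathlib
import Literature.Probability.MarkovChains.MetropolisHastings
import Literature.Probability.MarkovChains.TotalVariation
import Summits.Ventures.LatticeQCDFlow.Exactness.FlowMCMC
import Summits.Ventures.LatticeQCDFlow.Exactness.JarzynskiFinite
import Summits.Ventures.LatticeQCDFlow.Scaling.ImportanceWeights
import Summits.Ventures.LatticeQCDFlow.Scaling.StochasticFlows
import Summits.Ventures.LatticeQCDFlow.Scaling.StochasticBudgets
import Summits.Ventures.LatticeQCDFlow.Scaling.VarianceLaws
import Summits.Ventures.LatticeQCDFlow.Scaling.AnnealingStepLaw
import Summits.Ventures.LatticeQCDFlow.Scaling.AcceptanceTails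

/-!
# LatticeQCDFlow / Scaling — barrier-catalogue SUPPLEMENTS (v1.7 / v1.8): the reweighting window,
# the annealing step law, the acceptance tail law, the annealing work law

HONEST FRAMING: exact (Metropolis-corrected) sampling algorithms for lattice gauge theory;
figures of merit are autocorrelation/cost numbers at stated couplings and volumes; no
continuum-physics claim.

Venture `LatticeQCDFlow` (cell pub-lqcd).  Companion of `Scaling/Barriers.lean`,
`Scaling/BarriersStochastic.lean` (v1.5) and `Scaling/BarriersAcceptance.lean` (v1.6): the four
v1.7 / v1.8 supplements of HOME/THEORY-2-Sketch.lean (theory seat, FANOUT row 29; THEORY-2.md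
§5.8 / §5.9), in the same barrier-docstring format, each a `def … : Prop` whose body is the
PROVED finite core (`Scaling/{VarianceLaws, AnnealingStepLaw, AcceptanceTails}.lean`) and each
DISCHARGED by a theorem:

* `ReweightingWindowLaw` (cite under VolumeScalingOfTraining §5.1) — `ESS ≤ 1/(1 + Var_p log w)`:
  `reweightingWindowLaw`;
* `AnnealingStepLaw` (VolumeScalingOfTraining §5.1, PerfectRelaxationLaw) —
  `n_step ≥ σ²(Δβ)² ÊSS/(1 − ÊSS)` for any linear schedule with perfect relaxation, and the
  matching sufficiency: `annealingStepLaw`;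
* `AcceptanceTailLaw` (ExactnessVsExpressivity §5.3) — `acc ≤ e^{−J/2} + 16(Var_p ℓ + Var_q ℓ)/J²`:
  `acceptanceTailLaw`;
* `AnnealingWorkLaw` (v1.8; VolumeScalingOfTraining §5.1 evasion (iii)) — work `Ω(V²)` per
  weighted path at fixed path-ESS in the perfect-relaxation model: `annealingWorkLaw`.
OUR results (LEAN PLACEMENT RULE: under the Venture, not `Literature/Barriers/`); the printed
laws live in the docstrings.  The four barrier `def`s of record are unchanged.
-/

namespace Summit.Ventures.LatticeQCDFlow.Barriers

open Finset

/-! ### v1.7 (gen-6) supplements — variance laws: the reweighting window, the two-sided annealing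
step law, and the acceptance tail law (PROVED; cite under VolumeScalingOfTraining §5.1 (window,
step law) and ExactnessVsExpressivity §5.3 / AcceptanceBlindness (acceptance tails)).  The four
barrier `def`s of record are unchanged. -/

/-- **Supplement (ReweightingWindowLaw) to VolumeScalingOfTraining — the reweighting ESS is capped
by the TARGET-side variance of the log-weight: `ESS ≤ 1/(1 + Var_p log w)`.**  In general
`Var_p(ℓ) ≤ χ²(p‖q) = 1/ESS − 1`, `ℓ = log(p/q)` — the distribution-free, non-asymptotic companion
of the Gaussian heuristic `ESS = e^{−Var ℓ}` (T2-J) and of `ESS ≤ e^{−D(p‖q)}` (T2-A); conversely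
`χ² ≤ e^{M}·Var_p(ℓ)` when `ℓ` oscillates by at most `M`.  For two Gibbs laws `e^{−S_j}/Z_j`
(target) and `e^{−S_k}/Z_k` (sampled) the variance is that of the ACTION DIFFERENCE:
`Var_{p_j}(S_k − S_j) ≤ 1/ESS(p_j, p_k) − 1`; a one-parameter reweighting `βA → (β + h)A` has
`ESS ≤ 1/(1 + h²·Var_{β+h}(A))`, so at fixed ESS the admissible step is
`|h| ≤ √((1/ESS − 1)/Var A) ∝ V^{−1/2}` for an extensive `A` — the single-histogram REWEIGHTING
RANGE `|T − T₀|/T₀ ≤ 1/(√V·√C(T₀))`, `∝ V^{−1/2}` off criticality and `∝ L^{−1/ν}` at it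
[cite: Janke2012, §4.1.1 eqs. (65)–(66)]; "the reliable range of K values decreases
as the system size increases" [cite: LandauBinder2021, §7.2] — as a theorem.  The variance
under the MODEL does not bound the ESS (two-point example, THEORY-2.md §3.1).
technique_class: single-step reweighting / importance sampling between Gibbs laws (β- or
  mass-reweighting, multi-histogram hops, replica spacings, the individual steps of annealed /
  stochastic / CRAFT flows), and any flow used as a reweighting density whose log-weight has
  extensive variance under the target.
blocks: volume-independent reweighting steps or replica spacings at fixed ESS; inferring the ESS
  from the variance of log-weights measured under the model alone.
because: PROVED `Theory2.varLaw_logW_le_chiSq` (pair identity `Theory2.chiSq_eq_half_sum` and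
  `t² ≤ e^t + e^{−t} − 2`, `Theory2.sq_le_exp_add_exp_neg_sub_two`),
  `Theory2.essFrac_le_inv_one_add_varLaw`, converse `Theory2.chiSq_le_exp_mul_varLaw`
  (`e^t + e^{−t} − 2 ≤ t²e^{|t|}`); Gibbs forms `Theory2.varLaw_step_le_chiSq`, `Theory2.ess_step_le`,
  `Theory2.chiSq_step_le` (`Theory2.logW_gibbs`: the log-weight is the action difference up to a
  constant).
evasions_known: none at fixed pair `(p, q)` — it is an inequality; intermediate distributions
  (AnnealingStepLaw) move the cost into the number of steps; better models shrink `Var_p ℓ`.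
scope_caveats: one step, target-side variance; the converse needs a bounded oscillation `M`
  (heavy upper tails of `ℓ` make `χ² ≫ Var`); finite state space.
status: PROVED (`reweightingWindowLaw`). -/
def ReweightingWindowLaw : Prop :=
  ∀ (X : Type) [Fintype X] (p q : X → ℝ), (∀ x, 0 < p x) → (∀ x, 0 < q x) →
    ∑ x, p x = 1 → ∑ x, q x = 1 →
      Theory2.varLaw p (Theory2.logW p q) ≤ (Theory2.essFrac p q)⁻¹ - 1 ∧
      Theory2.essFrac p q ≤ (1 + Theory2.varLaw p (Theory2.logW p q))⁻¹

/-- The supplement `ReweightingWindowLaw` is a theorem (discharged from the PROVED finite cores). [folklore] -/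
theorem reweightingWindowLaw : ReweightingWindowLaw :=
  fun _ _ _ _ hp hq hp1 hq1 =>
    ⟨Theory2.varLaw_logW_le_chiSq hp hq hp1 hq1,
      Theory2.essFrac_le_inv_one_add_varLaw hp hq hp1 hq1⟩

/-- **Supplement (AnnealingStepLaw) to VolumeScalingOfTraining / PerfectRelaxationLaw — with
perfectly relaxing layers the NE-MCMC / Jarzynski reweighting ESS obeys
`log(1/ÊSS) ≍ Σ_k Var_{k+1}(ΔS_k) ≥ σ²(Δβ)²/n`, BOTH sides.**  Necessity: `ÊSS = Π_k ESS(p_{k+1}, p_k)`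
(T2-W) `≤ 1/(1 + Σ_k Var_{p_{k+1}}(S_{k+1} − S_k))`, and for ANY schedule `β_0, …, β_n` of a
protocol LINEAR in one coupling, `S_k = β_k·A`, with `Var_{β_k}(A) ≥ σ²` along the path,
`ÊSS ≤ 1/(1 + σ²(β_n − β_0)²/n)` (Cauchy–Schwarz over the steps: uneven schedules do not beat it),
i.e. `n ≥ σ²(Δβ)²·ÊSS/(1 − ÊSS)` — LINEAR IN THE VOLUME at fixed ÊSS for an extensive `A`
(`σ² = c·V`; for a defect / boundary-condition protocol, whose action is linear in the defect
coupling, `σ² ∝ n_dof` of the defect): the printed collapse `ÊSS = f(n_dof/n_step)`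
[cite: BonannoEtAl2026, §3.1; BulgarelliCelliniNada2025] DERIVED for the perfectly relaxing model
instead of assumed (T2-F).  Sufficiency: if every increment oscillates by `≤ M` over
configurations, `ÊSS ≥ exp(−e^{M}·Σ_k Var_{k+1}(ΔS_k))`, so `n = O(e^{M}(Δβ)²σ²_max/log(1/η))`
steps suffice for `ÊSS ≥ η`.  This is the finite-state, non-asymptotic, ESS-exact form of the
thermodynamic length–divergence asymptotics for step-equilibrated protocols (hysteresis
`= Σ_t Δλ·Δ⟨X⟩ ≈ 𝒥/N ≥ ℒ²/N` [cite: Crooks2007, eq. (hysteresis); Salamon–Berry 1983]) — the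
hysteresis sum is exactly the Jeffreys sum `Theory2.jeffreys_gibbs`, and the χ²-chain replaces the
`N → ∞` expansion.
technique_class: annealed / non-equilibrium (Jarzynski, NE-MCMC, stochastic normalizing, CRAFT)
  flows along a one-parameter family of actions with (near-)perfectly relaxing Monte-Carlo layers
  and a volume-independent number of protocol steps; replica ladders with fixed spacings.
blocks: `n_step` (or the number of replicas) uniform in the volume at fixed reweighting ESS;
  claims that a non-uniform schedule beats the `σ²(Δβ)²/n` law by more than the variance profile
  `σ²_max/σ²_min` allows.
because: PROVED `Theory2.prod_essFrac_le_inv` (`1 + Σ a_k ≤ Π (1 + a_k)`,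
  `Theory2.one_add_sum_le_prod_one_add`), `Theory2.prod_ess_linProtocol_le`
  (`sq_sum_le_card_mul_sum_sq` + telescoping), `Theory2.nsteps_linProtocol_ge`,
  `Theory2.prod_essFrac_ge_exp` (`1 + x ≤ eˣ`); on path space through T2-W
  `Theory2.ess_perfect_relaxation`: `Theory2.ess_perfect_relaxation_le_inv`,
  `Theory2.ess_perfect_relaxation_linProtocol_le`, `Theory2.ess_perfect_relaxation_ge_exp`.
evasions_known: CORRELATED (imperfect) layers are not covered and can do better (THEORY-2.md
  §3.5: the reflection protocol has `ESS = 1`; T2-W is a statement about the perfectly relaxing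
  model, not a lower bound over all kernels); learned deterministic layers between the stochastic
  ones (SNF / CRAFT) replace `ΔS_k` by `ΔS_k − log J_k` and can shrink its variance — the law then
  prices the RESIDUAL variance; parallel-in-`k` implementations pay `n ∝ V` in work, not in depth.
scope_caveats: perfect relaxation; the sufficiency side needs bounded increments; the schedule
  bound is for protocols linear in one coupling (general paths: the `Σ_k Var_k` form); finite
  state space.
status: PROVED (`annealingStepLaw`). -/
def AnnealingStepLaw : Prop :=
  ∀ (X : Type) [Fintype X] [Nonempty X] (β : ℕ → ℝ) (A : X → ℝ) (n : ℕ) (σ2 η : ℝ),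
    0 ≤ σ2 →
    (∀ k : Fin n, σ2 ≤ Theory2.varLaw (Exactness.gibbsLaw (Theory2.linProtocol β A n k.succ)) A) →
    η ≤ ∏ k : Fin n, Theory2.essFrac (Exactness.gibbsLaw (Theory2.linProtocol β A n k.succ))
        (Exactness.gibbsLaw (Theory2.linProtocol β A n k.castSucc)) →
      η * (σ2 * (β n - β 0) ^ 2) ≤ (1 - η) * n

/-- The supplement `AnnealingStepLaw` is a theorem (discharged from the PROVED finite cores). [folklore] -/
theorem annealingStepLaw : AnnealingStepLaw :=
  fun _ _ _ β A n _ _ hσ0 hσ hη => Theory2.nsteps_linProtocol_ge β A n hσ0 hσ hη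

/-- **Supplement (AcceptanceTailLaw) to ExactnessVsExpressivity / AcceptanceBlindness — the
acceptance DOES obey a volume law once the log-weight variances are sub-quadratic in the Jeffreys
divergence.**  For every `0 < J ≤ D(p‖q) + D(q‖p)`:
`acc(p, q) ≤ e^{−J/2} + 16·(Var_p ℓ + Var_q ℓ)/J²`, `ℓ = log(p/q)` (a threshold test plus
Chebyshev on both tails; the general form is `acc ≤ e^{−a} + p(ℓ < c) + q(ℓ > c − a)` for every
`c`, `a`, `Theory2.accRate_le_tails`).  With `m` model-independent blocks of defect `≥ δ`
(`D(p‖q) ≥ 2mδ²`, BlockDefectVolumeLaw) and `Var_p ℓ + Var_q ℓ ≤ B`: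
`acc ≤ e^{−mδ²} + 4B/(m²δ⁴) → 0` whenever `B = o(m²)` — in particular for target/model pairs with
summable correlations (`B = O(m)`), where at fixed acceptance `α > e^{−mδ²}` the block defect must
shrink like `δ⁴ ≤ 4B/(m²(α − e^{−mδ²}))`, forcing the receptive field to grow as in
ReceptiveFieldLaw.  The blindness family of AcceptanceBlindness (`p = (1−θ)q + θr`: acceptance
`≥ 1 − θ` at every volume) has `Var_p ℓ ∝ m²` — exactly the excluded regime.  Gaussian
counterpart `P_acc = erfc(√(σ²(ΔS)/8))` [cite: Finkenrath2022].  Sector form (L-9):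
`acc ≤ 1 − ‖π_*p − π_*q‖_TV` for every coarse-graining `π`.
technique_class: full-volume independence-Metropolis (flow-MCMC) proposals assessed by the mean
  acceptance, for target/model pairs with extensive KL and extensive (linear-in-volume)
  log-weight variances — clustering Gibbs targets against local models.
blocks: volume-independent acceptance at fixed per-site model quality for clustering pairs;
  reading a non-vanishing acceptance as small KL without a variance measurement; acceptance
  above `1 − ‖π_*p − π_*q‖_TV` for a model with a wrong sector histogram.
because: PROVED `Theory2.accRate_le_tails`, `Theory2.chebyshev_set`,
  `Theory2.accRate_le_of_jeffreys`, `Theory2.accRate_blocks_le`,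
  `Theory2.accRate_le_one_sub_tvDist_coarse` (L-7 `Theory2.accRate_le_accRate_coarse` + T2-E
  `Exactness.accRate_le`).
evasions_known: mixture-like (non-clustering) targets with `Var ℓ ∝ m²` (AcceptanceBlindness);
  sub-volume proposals; models whose defect shrinks with the volume (receptive field `∝ log V`).
scope_caveats: needs the variance budget — without it the acceptance is provably not controlled
  by KL (AcceptanceBlindness); constants `16`, `4` not optimised; finite state space.
status: PROVED (`acceptanceTailLaw`). -/
def AcceptanceTailLaw : Prop :=
  ∀ (X : Type) [Fintype X] (p q : X → ℝ) (J : ℝ), (∀ x, 0 < p x) → (∀ x, 0 < q x) →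
    ∑ x, p x = 1 → ∑ x, q x = 1 → 0 < J → J ≤ Theory2.klFin p q + Theory2.klFin q p →
      Exactness.accRate p q ≤ Real.exp (-(J / 2)) +
        16 * (Theory2.varLaw p (Theory2.logW p q) + Theory2.varLaw q (Theory2.logW p q)) / J ^ 2

/-- The supplement `AcceptanceTailLaw` is a theorem (discharged from the PROVED finite cores). [folklore] -/
theorem acceptanceTailLaw : AcceptanceTailLaw :=
  fun _ _ _ _ _ hp hq hp1 hq1 hJ0 hJ => Theory2.accRate_le_of_jeffreys hp hq hp1 hq1 hJ0 hJ


/-! ### v1.8 (gen-7) supplement — the annealing WORK law (PROVED; cite under VolumeScalingOfTraining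
§5.1 evasion (iii) "out-of-equilibrium / stochastic flows" and under PerfectRelaxationLaw). -/

/-- **Supplement (AnnealingWorkLaw) to VolumeScalingOfTraining, evasion (iii) "out-of-equilibrium /
stochastic flows", and to PerfectRelaxationLaw.**  In the perfect-relaxation model of a stepped
protocol `p_0 → p_1 → … → p_n` with Gibbs laws `p_k ∝ e^{−β_k A}` (any schedule `β`), if each step
costs at least `c·V` (one sweep) and the stepwise variance of `A` is extensive (`a·V ≤ Var_{p_{k+1}} A`:
for `A` = the Wilson action a positive specific heat per plaquette, uniformly in `V` — a mild physics
input, automatic at strong coupling from the cluster expansion, NOT supplied here), then every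
protocol reaching path-ESS `≥ η` does work `W = n·c·V` with `η·a·c·V²·(β_n − β_0)² ≤ (1 − η)·W`:
quadratic in the volume at fixed ESS and fixed coupling interval.  Printed as a heuristic law —
"`δt ∼ 1/V`, `O(V)` steps, `O(V²)` effort … matches empirical observations with SNFs"
[cite: Abbott2025Thesis, §3.7 eq. (3.158)]; `n_step ∝ V` at fixed ESS [cite: BonannoEtAl2026, §4] —
and a THEOREM of the model here.
technique_class: Jarzynski / AIS / NE-MCMC / SNF / CRAFT-type annealed importance sampling with
  GLOBAL path weights and kernels idealised as perfectly relaxing between steps.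
blocks: claims that an annealed exact sampler with global weights reaches fixed ESS with `o(V)`
  steps of extensive-variance increments; cost tables that report steps but not steps × sweep cost.
because: PROVED `Theory2.work_linProtocol_ge` (from `Theory2.nsteps_linProtocol_ge`,
  `Theory2.prod_ess_linProtocol_le`, `Theory2.prod_essFrac_le_inv`).
evasions_known: (i) IMPERFECT but CHEAP kernels — the model's hypothesis fails and the printed
  annealed-HMC fit `−log ESS/V = A/(N_t ε_t^{3/2}) + …` gives `O(V^{23/12})`, order-`n` integrators
  `O(V^{5/3+1/(2n)})` [cite: Abbott2025Thesis, §3.7] — below `V²`, above `V^{5/3}`; (ii) NON-GLOBAL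
  weights: if target and path factorise over blocks and each block is weighted / resampled on its
  own, `−log ESS` adds over blocks at fixed per-block cost (`Theory2.essFrac_prodLaw`), so work is
  LINEAR in the number of blocks — the multilevel / domain-decomposition escape; (iii) better
  increments: a learned flow layer per step shrinks `Var(ΔS_k − log J_k)`, not its extensivity;
  the constant `a` drops, the power of `V` does not.
scope_caveats: a theorem about the perfect-relaxation MODEL (product of stepwise ESS); real kernels
  can be better (cheaper steps, (i)) or worse (lag); the `(β_n − β_0)²` is the linear-protocol
  form — for a general path replace it by the squared thermodynamic length (Jeffreys form T2-AD,
  the Cauchy–Schwarz step of `prod_ess_linProtocol_le`).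
status: PROVED (model; `annealingWorkLaw`) + printed heuristic + printed escape (empirical). -/
def AnnealingWorkLaw : Prop :=
  ∀ (X : Type) [Fintype X] [Nonempty X] (β : ℕ → ℝ) (A : X → ℝ) (n : ℕ) (a c V η : ℝ),
    0 ≤ a → 0 ≤ c → 0 ≤ V →
    (∀ k : Fin n, a * V ≤ Theory2.varLaw (Exactness.gibbsLaw (Theory2.linProtocol β A n k.succ)) A) →
    η ≤ ∏ k : Fin n, Theory2.essFrac (Exactness.gibbsLaw (Theory2.linProtocol β A n k.succ))
        (Exactness.gibbsLaw (Theory2.linProtocol β A n k.castSucc)) →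
      η * (a * c * V ^ 2 * (β n - β 0) ^ 2) ≤ (1 - η) * (n * (c * V))

/-- The supplement `AnnealingWorkLaw` is a theorem (discharged from the PROVED finite cores). [folklore] -/
theorem annealingWorkLaw : AnnealingWorkLaw :=
  fun _ _ _ β A n _ _ _ _ ha hc hV hσ hη => Theory2.work_linProtocol_ge β A n ha hc hV hσ hη

end Summit.Ventures.LatticeQCDFlow.Barriers
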